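import Summits.BirchSwinnertonDyer.BirchSwinnertonDyer.Theorems.ErratumRoadFiveCharIdealTransferTorsion
import HarnessLib

/-!
# K2 crux 19270 `IMCDivAtErratumDataAll` (H3♭), ROAD FF — the TORSION-ONLY end forms
# (no erratum Lemma 2.2) at module, Selmer and crux level

Cell `bsd-stepL`, seat `bsd-stepL-imc-p1` (g7). `--supports stmt-BirchSwinnertonDyer-19270 --as helper`.
HONEST FRAMING: BSD is not proved for any pair by this file; it closes no item; no definition, no
named fact, no `sorry`. Sequel of `ErratumRoadFiveIMCDivTransferTwoRing.lean` (p470728: two-ring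
one-sided transfer with `hnf`) and `ErratumRoadFiveCharIdealTransferTorsion.lean` (the 𝔪^k-trick
`Fitt₀(M)·𝒪'⟦T⟧ ⊆ (L) ⟹ char(M)·𝒪'⟦T⟧ ⊆ (L)` for torsion `M`): here the three end forms of p470728
(§1 module level, §2 Selmer level, §4 crux conjunct) are re-derived with the intermediate receptacle
`S = 𝒪'⟦T⟧` (`𝒪 → 𝒪'` an injective map from a DVR to a PID, e.g. `ℤ_p ⊆ 𝒪 → 𝒪^{ur}`) and
WITHOUT the input `hnf` = erratum Lemma 2.2 "no nonzero finite-index submodule of `X_f`" (F6 of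
SPEC-19270-RoadFF), whose printed support at erratum data is thin ([HL19, Prop. 3.12] has
`N̄⁻ = 1`; [Gre16, Prop. 4.1.1]'s hypotheses are unverified there — LIT-DOSSIER §20.7 ∕ §20.10 (γ)).
What Road FF now asks of `X_f = Sel^Σ(M_f)^∨`: torsionness only — at an erratum datum the tree
THEOREM `X11b.controlUpperOnTreeAt_of_isErratumField` ⊢ `XAc.HasCharValuationAt … n`, whose first
conjunct is `Module.IsTorsion Λ (X^Σ_ac(E[p^∞]))`, transported to `X_f` by F1 (Shapiro).

Contents: §5 `CongruenceLimit.map_charIdeal_le_span_of_congruences_torsion` (module level);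
§6 `TorsionControl.map_charIdeal_le_span_of_selmer_congruences_torsion` (Selmer level) and
`AcSelmer.XAc.map_charIdeal_le_span_of_roadFF_torsion` (the crux's divisibility conjunct
`(XAc.charIdeal W p κ 𝔭 ∅ γ).map (PowerSeries.map (R1.toCpInt p)) ≤ Ideal.span {Q}` VERBATIM).
Dictionary of hypotheses (D1 ∕ D2 ∕ F1–F5 ∕ F7) as in p470728's module docstring.

References: [Castella2018Erratum] Lemma 2.1, 2.2, Thm. 2.3, proof of Thm. 1.1 (p. 4);
[Skinner2016PacificMC] §2.6, §3.1; [FouquetWan2021] Thm. 4.41 (PREPRINT); [Castella2020] Thm. 2.11;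
[Castella2018] (3.1), Thm. 3.1; [JetchevSkinnerWan2017] Prop. 3.3.2, Thm. 6.1.6.
-/

noncomputable section

open scoped TensorProduct
open Literature.RingTheory.FittingIdeal Literature.NumberTheory.EllipticCurves
  Literature.NumberTheory.EllipticCurves.Module

namespace Summit.BirchSwinnertonDyer.Rank1Residual.X11b.CongruenceLimit

/-! ### §5 The `hnf`-free end form of Road FF at module level (`S = 𝒪'⟦T⟧`) -/

section EndForms

open PowerSeries IsLocalRing

variable {𝒪 : Type} [CommRing 𝒪] [IsDomain 𝒪] [IsDiscreteValuationRing 𝒪]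
  {𝒪' : Type} [CommRing 𝒪'] [IsDomain 𝒪'] [IsPrincipalIdealRing 𝒪'] [Algebra 𝒪 𝒪']

/-- **Two-ring one-sided congruence limit, TORSION-ONLY form** (`S = 𝒪'⟦T⟧`, `𝒪 → 𝒪'` injective):
inputs `e m` [(b) + Lemma 2.1], `hCh m` [(2.5) for `g_m`, mapped: `Ch(N_m)·𝒪'⟦T⟧ ⊆ (L_m)` when
`N_m` is torsion], `hc m` [(c)], and `hT` [`M` torsion] — NO "no finite submodule" input. Output:
`Ch_{𝒪⟦T⟧}(M)·𝒪'⟦T⟧ ⊆ (L)`. [cite: Castella2018Erratum, proof of Thm. 1.1 (p. 4), read one-sidedly, Lemma 2.2 bypassed]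
[cite: Skinner2016PacificMC, §3.1 (p. 192)] -/
theorem map_charIdeal_le_span_of_congruences_torsion
    (hι : Function.Injective (algebraMap 𝒪 𝒪'))
    {M : Type*} [AddCommGroup M] [Module 𝒪⟦X⟧ M] [Module.Finite 𝒪⟦X⟧ M]
    (N : ℕ → Type*) [∀ m, AddCommGroup (N m)] [∀ m, Module 𝒪⟦X⟧ (N m)]
    [∀ m, Module.Finite 𝒪⟦X⟧ (N m)]
    (I : Ideal 𝒪⟦X⟧) (hI : I.map (algebraMap 𝒪⟦X⟧ 𝒪'⟦X⟧) ≤ (⊥ : Ideal 𝒪'⟦X⟧).jacobson)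
    {L : 𝒪'⟦X⟧} (Lm : ℕ → 𝒪'⟦X⟧)
    (e : ∀ m : ℕ, 1 ≤ m →
      ((M ⧸ (I ^ m • (⊤ : Submodule 𝒪⟦X⟧ M))) ≃ₗ[𝒪⟦X⟧]
        (N m ⧸ (I ^ m • (⊤ : Submodule 𝒪⟦X⟧ (N m))))))
    (hCh : ∀ m : ℕ, 1 ≤ m → Module.IsTorsion 𝒪⟦X⟧ (N m) →
      (charIdeal 𝒪⟦X⟧ (N m)).map (algebraMap 𝒪⟦X⟧ 𝒪'⟦X⟧) ≤ Ideal.span {Lm m})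
    (hc : ∀ m : ℕ, 1 ≤ m → Ideal.span {Lm m} ⊔ (I.map (algebraMap 𝒪⟦X⟧ 𝒪'⟦X⟧)) ^ m =
      Ideal.span {L} ⊔ (I.map (algebraMap 𝒪⟦X⟧ 𝒪'⟦X⟧)) ^ m)
    (hT : Module.IsTorsion 𝒪⟦X⟧ M) :
    (charIdeal 𝒪⟦X⟧ M).map (algebraMap 𝒪⟦X⟧ 𝒪'⟦X⟧) ≤ Ideal.span {L} := by
  have hFitt : (Module.fittingIdeal 𝒪⟦X⟧ M 0).map (algebraMap 𝒪⟦X⟧ 𝒪'⟦X⟧) ≤ Ideal.span {L} :=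
    map_fittingIdeal_le_span_of_congruences 𝒪'⟦X⟧ N I hI Lm e
      (fun m hm => map_fittingIdeal_zero_le_of_map_charIdeal_le 𝒪'⟦X⟧ (algebraMap 𝒪⟦X⟧ 𝒪'⟦X⟧)
        (hCh m hm)) hc
  exact map_charIdeal_le_span_of_map_fittingIdeal_le (algebraMap 𝒪 𝒪') hι hT hFitt

end EndForms

end Summit.BirchSwinnertonDyer.Rank1Residual.X11b.CongruenceLimit

/-! ### §6 The `hnf`-free Selmer-level and crux-level end forms -/

namespace Summit.BirchSwinnertonDyer.Rank1Residual.X11b.TorsionControl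

open CategoryTheory Literature.NumberTheory.GaloisRepresentations IsLocalRing PowerSeries
open scoped ContRepresentation

variable {𝒪 : Type} [CommRing 𝒪] [IsDomain 𝒪] [IsDiscreteValuationRing 𝒪]
  [TopologicalSpace (PowerSeries 𝒪)]
  {𝒪' : Type} [CommRing 𝒪'] [IsDomain 𝒪'] [IsPrincipalIdealRing 𝒪'] [Algebra 𝒪 𝒪']
variable {Γ₀ : Type} [Group Γ₀] [TopologicalSpace Γ₀] [IsTopologicalGroup Γ₀]
variable {ι₀ : Type*} {Γw : ι₀ → Type} [∀ v, Group (Γw v)] [∀ v, TopologicalSpace (Γw v)]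
  [∀ v, IsTopologicalGroup (Γw v)] (ψ : ∀ v, Γw v →ₜ* Γ₀) (L₀ : Set ι₀)

/-- **`Ch_{Λ_𝒪}(Sel(M_f)^∨)·𝒪'⟦T⟧ ⊆ (L_f)`, TORSION-ONLY form** — the twin of
`map_charIdeal_le_span_of_selmer_congruences` (p470728 §2) with `S = 𝒪'⟦T⟧` (`𝒪 → 𝒪'`
injective, `𝒪'` a PID: `𝒪^{ur}`) and WITHOUT the input `hnf` (erratum Lemma 2.2 for `f`):
Lemma 2.1 in socle form (F5), `θ m` (F2), `hCh m` (F4, one inclusion for the `g_m`, in `𝒪'⟦T⟧`),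
`hc m` (F3), `hT` (`X_f` torsion). [cite: Castella2018Erratum, Lemma 2.1 and proof of Thm. 1.1 (p. 4), read one-sidedly, Lemma 2.2 bypassed]
[cite: Skinner2016PacificMC, §2.6 (2-6-1) and §3.1 (p. 192)] -/
theorem map_charIdeal_le_span_of_selmer_congruences_torsion
    (hι : Function.Injective (algebraMap 𝒪 𝒪'))
    (a : PowerSeries 𝒪) (I : Ideal (PowerSeries 𝒪))
    {Mf : Type} [AddCommGroup Mf] [Module (PowerSeries 𝒪) Mf] [TopologicalSpace Mf]
    [DiscreteTopology Mf] [ContinuousSMul (PowerSeries 𝒪) Mf] (ρf : ContinuousRep Γ₀ (PowerSeries 𝒪) Mf)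
    (hdivf : Function.Surjective fun x : Mf => a • x)
    (hprimf : ∀ x : Mf, ∃ n : ℕ, ∀ b ∈ I ^ n, b • x = 0)
    (hsocf : ∀ x : Mf, (∀ b ∈ I, b • x = 0) → (∀ g : Γ₀, ρf g x = x) → x = 0)
    (hsoclf : ∀ v ∈ L₀, ∀ x : Mf, (∀ b ∈ I, b • x = 0) → (∀ h : Γw v, ρf (ψ v h) x = x) → x = 0)
    (Mg : ℕ → Type) [∀ m, AddCommGroup (Mg m)] [∀ m, Module (PowerSeries 𝒪) (Mg m)]
    [∀ m, TopologicalSpace (Mg m)] [∀ m, DiscreteTopology (Mg m)]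
    [∀ m, ContinuousSMul (PowerSeries 𝒪) (Mg m)] (ρg : ∀ m, ContinuousRep Γ₀ (PowerSeries 𝒪) (Mg m))
    (hdivg : ∀ m, 1 ≤ m → Function.Surjective fun x : Mg m => a • x)
    (hprimg : ∀ m, 1 ≤ m → ∀ x : Mg m, ∃ n : ℕ, ∀ b ∈ I ^ n, b • x = 0)
    (hsocg : ∀ m, 1 ≤ m → ∀ x : Mg m, (∀ b ∈ I, b • x = 0) → (∀ g : Γ₀, ρg m g x = x) → x = 0)
    (hsoclg : ∀ m, 1 ≤ m → ∀ v ∈ L₀, ∀ x : Mg m, (∀ b ∈ I, b • x = 0) →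
      (∀ h : Γw v, ρg m (ψ v h) x = x) → x = 0)
    (θ : ∀ m, 1 ≤ m → ((torsionRep (ρg m) (a ^ m)).toTopRep ≅ (torsionRep ρf (a ^ m)).toTopRep))
    [Module.Finite (PowerSeries 𝒪) (CharacterModule (selmer ψ L₀ ρf))]
    [∀ m, Module.Finite (PowerSeries 𝒪) (CharacterModule (selmer ψ L₀ (ρg m)))]
    (ha : (Ideal.span {a}).map (algebraMap (PowerSeries 𝒪) (PowerSeries 𝒪')) ≤
      (⊥ : Ideal (PowerSeries 𝒪')).jacobson)
    {Lf : PowerSeries 𝒪'} (Lg : ℕ → PowerSeries 𝒪')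
    (hCh : ∀ m, 1 ≤ m → Module.IsTorsion (PowerSeries 𝒪) (CharacterModule (selmer ψ L₀ (ρg m))) →
      (charIdeal (PowerSeries 𝒪) (CharacterModule (selmer ψ L₀ (ρg m)))).map
        (algebraMap (PowerSeries 𝒪) (PowerSeries 𝒪')) ≤ Ideal.span {Lg m})
    (hc : ∀ m, 1 ≤ m →
      Ideal.span {Lg m} ⊔ ((Ideal.span {a}).map (algebraMap (PowerSeries 𝒪) (PowerSeries 𝒪'))) ^ m =
        Ideal.span {Lf} ⊔ ((Ideal.span {a}).map (algebraMap (PowerSeries 𝒪) (PowerSeries 𝒪'))) ^ m)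
    (hT : Module.IsTorsion (PowerSeries 𝒪) (CharacterModule (selmer ψ L₀ ρf))) :
    (charIdeal (PowerSeries 𝒪) (CharacterModule (selmer ψ L₀ ρf))).map
        (algebraMap (PowerSeries 𝒪) (PowerSeries 𝒪')) ≤ Ideal.span {Lf} :=
  CongruenceLimit.map_charIdeal_le_span_of_congruences_torsion hι
    (fun m => CharacterModule (selmer ψ L₀ (ρg m))) (Ideal.span {a}) ha Lg
    (fun m hm => Classical.choice
      (PontryaginCongruence.nonempty_quotIdealPow_equiv_of_torsionBy_equiv a m
        (Classical.choice (nonempty_torsionBy_selmer_equiv_of_socle ψ L₀ a I m ρf (ρg m) hdivf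
          hprimf hsocf hsoclf (hdivg m hm) (hprimg m hm) (hsocg m hm) (hsoclg m hm) (θ m hm)))))
    hCh hc hT

end Summit.BirchSwinnertonDyer.Rank1Residual.X11b.TorsionControl

namespace Summit.BirchSwinnertonDyer.Rank1Residual.X11b.AcSelmer.XAc

open CategoryTheory Literature.NumberTheory.GaloisRepresentations IsLocalRing NumberField
  IsDedekindDomain Field TorsionControl PowerSeries
open scoped ContRepresentation

/-- **ROAD FF, KERNEL GLUE, TORSION-ONLY form** — the twin of `map_charIdeal_le_span_of_roadFF`
(p470728 §4) with the intermediate receptacle `S = 𝒪'⟦T⟧` (`𝒪 → 𝒪'` injective, `𝒪'` a PID)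
and WITHOUT F6 = erratum Lemma 2.2: on `X_f = Sel^Σ(M_f)^∨` only TORSIONNESS is asked (at an
erratum datum: the tree theorem `controlUpperOnTreeAt_of_isErratumField` gives
`XAc.HasCharValuationAt`, whose first conjunct is torsionness of `X^Σ_ac(E[p^∞])`, transported by
F1). Conclusion: the crux conjunct `Ch_Λ(X^∅_ac)·𝓞_{ℂ_p}⟦T⟧ ⊆ (Q)` VERBATIM. CONDITIONAL on its
hypotheses only; closes nothing; BSD proved for no pair.
[cite: Castella2018Erratum, Thm. 1.1 ⇐ Thm. 2.3, proof p. 4, read one-sidedly, Lemma 2.2 bypassed]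
[cite: Skinner2016PacificMC, §3.1 (p. 192)] [cite: Castella2018, (3.1) and Thm. 3.1]
[cite: JetchevSkinnerWan2017, Prop. 3.3.2 and Thm. 6.1.6 (proof)] -/
theorem map_charIdeal_le_span_of_roadFF_torsion
    {K : Type} [Field K] [NumberField K] (W : WeierstrassCurve K) (p : ℕ) [Fact p.Prime]
    (κ : ZpExtension K p) (𝔭 : HeightOneSpectrum (𝓞 K)) (Sg : Set (HeightOneSpectrum (𝓞 K)))
    (γ : absoluteGaloisGroup K) [Fact (κ.IsTopGenerator γ)]
    -- receptacle
    {𝒪 : Type} [CommRing 𝒪] [IsDomain 𝒪] [IsDiscreteValuationRing 𝒪]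
    [TopologicalSpace (PowerSeries 𝒪)]
    {𝒪' : Type} [CommRing 𝒪'] [IsDomain 𝒪'] [IsPrincipalIdealRing 𝒪'] [Algebra 𝒪 𝒪']
    (hι : Function.Injective (algebraMap 𝒪 𝒪'))
    (i : IwasawaAlgebra p →+* PowerSeries 𝒪) (j : PowerSeries 𝒪' →+* PowerSeries 𝓞_ℂ_[p])
    (hcomp : j.comp ((algebraMap (PowerSeries 𝒪) (PowerSeries 𝒪')).comp i) =
      PowerSeries.map (R1.toCpInt p))
    (a : PowerSeries 𝒪) (ha : (Ideal.span {a}).map (algebraMap (PowerSeries 𝒪) (PowerSeries 𝒪')) ≤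
      (⊥ : Ideal (PowerSeries 𝒪')).jacobson) (I : Ideal (PowerSeries 𝒪))
    -- Galois side over `Λ_𝒪`
    {Γ₀ : Type} [Group Γ₀] [TopologicalSpace Γ₀] [IsTopologicalGroup Γ₀]
    {ι₀ : Type*} {Γw : ι₀ → Type} [∀ v, Group (Γw v)] [∀ v, TopologicalSpace (Γw v)]
    [∀ v, IsTopologicalGroup (Γw v)] (ψ : ∀ v, Γw v →ₜ* Γ₀) (L₀ : Set ι₀)
    {Mf : Type} [AddCommGroup Mf] [Module (PowerSeries 𝒪) Mf] [TopologicalSpace Mf]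
    [DiscreteTopology Mf] [ContinuousSMul (PowerSeries 𝒪) Mf] (ρf : ContinuousRep Γ₀ (PowerSeries 𝒪) Mf)
    (hdivf : Function.Surjective fun x : Mf => a • x)
    (hprimf : ∀ x : Mf, ∃ n : ℕ, ∀ b ∈ I ^ n, b • x = 0)
    (hsocf : ∀ x : Mf, (∀ b ∈ I, b • x = 0) → (∀ g : Γ₀, ρf g x = x) → x = 0)
    (hsoclf : ∀ v ∈ L₀, ∀ x : Mf, (∀ b ∈ I, b • x = 0) → (∀ h : Γw v, ρf (ψ v h) x = x) → x = 0)
    (Mg : ℕ → Type) [∀ m, AddCommGroup (Mg m)] [∀ m, Module (PowerSeries 𝒪) (Mg m)]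
    [∀ m, TopologicalSpace (Mg m)] [∀ m, DiscreteTopology (Mg m)]
    [∀ m, ContinuousSMul (PowerSeries 𝒪) (Mg m)] (ρg : ∀ m, ContinuousRep Γ₀ (PowerSeries 𝒪) (Mg m))
    (hdivg : ∀ m, 1 ≤ m → Function.Surjective fun x : Mg m => a • x)
    (hprimg : ∀ m, 1 ≤ m → ∀ x : Mg m, ∃ n : ℕ, ∀ b ∈ I ^ n, b • x = 0)
    (hsocg : ∀ m, 1 ≤ m → ∀ x : Mg m, (∀ b ∈ I, b • x = 0) → (∀ g : Γ₀, ρg m g x = x) → x = 0)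
    (hsoclg : ∀ m, 1 ≤ m → ∀ v ∈ L₀, ∀ x : Mg m, (∀ b ∈ I, b • x = 0) →
      (∀ h : Γw v, ρg m (ψ v h) x = x) → x = 0)
    (θ : ∀ m, 1 ≤ m → ((torsionRep (ρg m) (a ^ m)).toTopRep ≅ (torsionRep ρf (a ^ m)).toTopRep))
    [Module.Finite (PowerSeries 𝒪) (CharacterModule (selmer ψ L₀ ρf))]
    [∀ m, Module.Finite (PowerSeries 𝒪) (CharacterModule (selmer ψ L₀ (ρg m)))]
    -- F1 (Shapiro, inequality direction) and F7 (Σ-removal)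
    (hSh : (XAc.charIdeal W p κ 𝔭 Sg γ).map i ≤
      Literature.NumberTheory.EllipticCurves.Module.charIdeal (PowerSeries 𝒪)
        (CharacterModule (selmer ψ L₀ ρf)))
    {PS : IwasawaAlgebra p}
    (hSig : XAc.charIdeal W p κ 𝔭 Sg γ = XAc.charIdeal W p κ 𝔭 ∅ γ * Ideal.span {PS})
    (hP : algebraMap (PowerSeries 𝒪) (PowerSeries 𝒪') (i PS) ≠ 0)
    {LS Lf : PowerSeries 𝒪'}
    (hLS : Ideal.span {LS} = Ideal.span {algebraMap (PowerSeries 𝒪) (PowerSeries 𝒪') (i PS) * Lf})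
    -- F4 and F3 in `𝒪'⟦T⟧`, torsionness of `X_f`
    (Lg : ℕ → PowerSeries 𝒪')
    (hCh : ∀ m, 1 ≤ m → Module.IsTorsion (PowerSeries 𝒪) (CharacterModule (selmer ψ L₀ (ρg m))) →
      (Literature.NumberTheory.EllipticCurves.Module.charIdeal (PowerSeries 𝒪)
        (CharacterModule (selmer ψ L₀ (ρg m)))).map
        (algebraMap (PowerSeries 𝒪) (PowerSeries 𝒪')) ≤ Ideal.span {Lg m})
    (hc : ∀ m, 1 ≤ m →
      Ideal.span {Lg m} ⊔ ((Ideal.span {a}).map (algebraMap (PowerSeries 𝒪) (PowerSeries 𝒪'))) ^ m =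
        Ideal.span {LS} ⊔ ((Ideal.span {a}).map (algebraMap (PowerSeries 𝒪) (PowerSeries 𝒪'))) ^ m)
    (hT : Module.IsTorsion (PowerSeries 𝒪) (CharacterModule (selmer ψ L₀ ρf)))
    -- the frame in the final receptacle
    {Q : PowerSeries 𝓞_ℂ_[p]} (hQ : Ideal.span {j Lf} = Ideal.span {Q}) :
    (XAc.charIdeal W p κ 𝔭 ∅ γ).map (PowerSeries.map (R1.toCpInt p)) ≤ Ideal.span {Q} := by
  have h𝔠 := map_charIdeal_le_span_of_selmer_congruences_torsion ψ L₀ hι a I ρf hdivf hprimf hsocf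
    hsoclf Mg ρg hdivg hprimg hsocg hsoclg θ ha Lg hCh hc hT
  rw [← hcomp]
  exact CongruenceLimit.map_le_span_of_transfer_of_imprimitive i
    (algebraMap (PowerSeries 𝒪) (PowerSeries 𝒪')) j hSig hP hSh h𝔠 hLS hQ

end Summit.BirchSwinnertonDyer.Rank1Residual.X11b.AcSelmer.XAc

end
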